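import Literature.MathematicalPhysics.QuantumFieldTheory.Balaban1983to89.B9Eq349LaplacePrimeBlockLetters

/-!
# `Balaban1983to89.B9Eq387CubeCutoffProfile` — T. Bałaban, *Propagators for lattice gauge theories in a background field*, Commun. Math. Phys. **99** (1985)
# 389–434 [Balaban1985BackgroundPropagators] p. 408 («h_□ ∈ C^∞, h_□ = 1 on □, supported in □̃») with (3.87)–(3.89) p. 409 and (3.100) p. 413 («O(M⁻¹), or O(M⁻²) … on a
# proper scale»): **A CUBE CUT-OFF PROFILE ON THE FINE TORUS, CONSTRUCTED — for a coarse set `Y₀`, a radius `r₀` and a collar width `R > 0` there is a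
# REAL profile `σ` on the fine torus, constant on blocks, with `0 ≤ σ ≤ 1`, `σ = 1` on the blocks within `r₀` of `Y₀`, `σ = 0` on the blocks at distance
# `≥ r₀ + R` from `Y₀`, bond slopes `|σ(b₋) − σ(b₊)| ≤ 1∕R` and second differences `≤ 2∕R`** — the profile letters of ne9-leaf-05 g77's (K7-B)
# `B9Eq389CubeLocalisedProjectionProfile.norm_sub_projR_blockHull_le_of_profile` (`ℓ₁η := 1∕R`, `ℓ₂η² := 2∕R`) INHABITED; route R2′ STEP B7′∕B8′, S-P6′(β),
# instance-ledger rows L1 («the lattice `χ_j` themselves = HYPOTHESES») and L10 (loc) of the pub-balaban NE9 chain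

statement-level skeleton of published theorems with citation tags; proofs where landed; nothing here is a claim about the Yang–Mills mass gap

CITATION HEADER (lean-in-tree rule).  Audit cell `pub-balaban`, sub-cell `t4`, BINDER row NE9; filed by NE9 formalisation-swarm LEAF PROVER 05
(`b2b-balaban-t4-ne9-formalise-leaf-05`, gen 77).  CONSTRUCTION (inside the proof; no `def`): `σ(x) = ρ(D(blk x))` with `D(y) = min_{y₀ ∈ Y₀} d_m(y₀, y)` (the
torus sup-distance `B4Sect5Torus.tdist` to `Y₀`, `1`-Lipschitz by `tdist_triangle`) and the ramp `ρ(t) = max 0 (min 1 ((r₀ + R − t)∕R))` (`1∕R`-Lipschitz); one fine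
lattice step moves the block coordinate by at most one coarse unit (ne9-leaf-01 g85's `B9Eq349LaplacePrimeBlockLetters.tdist_blockCoord_shift_le_one` ∕
`tdist_blockCoord_unshift_le_one`).  CONSUMER BY SHAPE: the five profile letters `hσ1, hnear, hσY, h1, h2` of `B9Eq389CubeLocalisedProjectionProfile` and of
`B9Eq388KhLettersUnitWindow`.  Source READ in the held text [Balaban1985BackgroundPropagators]: p. 408 *«Let us take a function h_□ ∈ C^∞ … h_□ = 1 on □ …»*,
p. 409 (3.87)–(3.89), p. 413 (3.100).  Print's `h_□` is smooth on the PHYSICAL scale `M`; the block-constant lattice profile below has slope `1∕R` per block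
boundary (`R` = collar width in coarse blocks = physical units at `Lη = 1`), i.e. `ℓ₁ = L∕R`, `ℓ₂ = 2L²∕R` in the consumer's letters — «O(M⁻¹)» with `M = R`
up to the fixed `L`; the `O(M⁻²)` second-difference refinement of a smooth profile is NOT attempted (not needed by the consumer: every size enters linearly).

WHAT IS PROVED (sorry-free; proof lane — no `def`; [folklore] metric bookkeeping on the discrete torus).
* §1 (private [folklore] helpers) `abs_ramp_sub_ramp_le` (the ramp is `1∕R`-Lipschitz, values in `[0,1]`, `= 1` below `r₀`, `= 0` above `r₀ + R`: `ramp_mem`,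
  `ramp_eq_one`, `ramp_eq_zero`), `abs_infDist_sub_infDist_le` (the distance to a nonempty finite set is `1`-Lipschitz for `tdist`).
* §2 **`exists_cube_cutoff_profile`** — the profile with the five properties above (for `Y₀ = ∅` the zero profile).
* §3 **`exists_cube_cutoff_profile_letters`** — the same in the CONSUMER's spelling on the diagonal `Lη = 1`: `|σ x − 1| ≤ 1`, `σ = 1` on
  `{x : ∃ y₀ ∈ Y₀, d_m(y₀, blk x) < r₀}`, `σ = 0` off `Y := {y : ∃ y₀ ∈ Y₀, d_m(y₀, y) < r₀ + R}`, `|σ(b₋) − σ(b₊)| ≤ (L∕R)·η`, second differences `≤ (2L²∕R)·η²`.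
HONEST SCOPE.  A lattice cut-off with crude (first-order) second differences; no smoothness on the block scale; the cube `Y ⊇ r₀ + R`-neighbourhood is the
consumer's choice; nothing of [B9] asserted.  NOT NE9 (cell pub-balaban: NE9 NOT PRINTED ∕ NOT PROVED; «NE9 ⇐ the named binders»; row WALLED ON A MODEL (O-NE9-1;
#5 UNRULED); spine PROVED 0∕9; rung (B)+1 on a finite T⁴ — NOT infinite volume, NOT mass gap, NOT Clay; HONEST DEPENDENCY: continuum YM on T⁴ ⇐ BetaPertH ∧ nine
spine estimates (0/9 proved); BetaPertH ⇐ (D1) ∧ (D4) ∧ CAP+tail; G-an2-4 gates asym, D1 and NE2/3/4).  NEW file; nothing modified.  Net new unproved facts: 0.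
-/

noncomputable section

set_option autoImplicit false

namespace Literature.MathematicalPhysics.QuantumFieldTheory.Balaban1983to89.B9Eq387CubeCutoffProfile

open B4Sect5Torus (TSite tdist tdist_self tdist_triangle tdist_nonneg tdist_symm)
open B9SectCLatticeCarrier (Bond bpos btgt shift unshift)
open B9Eq319QprimeTorus (fineP blockCoord)
open B9Eq349LaplacePrimeBlockLetters (tdist_blockCoord_shift_le_one tdist_blockCoord_unshift_le_one)

/-! ## §1 The ramp and the distance to a finite set -/

section Ramp

variable {r₀ R : ℝ}

/-- the ramp `ρ(t) = max 0 (min 1 ((r₀ + R − t)∕R))` takes values in `[0, 1]`. [folklore] -/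
private theorem ramp_mem (t : ℝ) : 0 ≤ max 0 (min 1 ((r₀ + R - t) / R)) ∧ max 0 (min 1 ((r₀ + R - t) / R)) ≤ 1 :=
  ⟨le_max_left _ _, max_le zero_le_one (min_le_left _ _)⟩

/-- below `r₀` the ramp is `1` (`0 < R`). [folklore] -/
private theorem ramp_eq_one (hR : 0 < R) {t : ℝ} (ht : t ≤ r₀) : max 0 (min 1 ((r₀ + R - t) / R)) = 1 := by
  have h1 : 1 ≤ (r₀ + R - t) / R := by rw [le_div_iff₀ hR]; linarith
  rw [min_eq_left h1, max_eq_right zero_le_one]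

/-- above `r₀ + R` the ramp is `0` (`0 < R`). [folklore] -/
private theorem ramp_eq_zero (hR : 0 < R) {t : ℝ} (ht : r₀ + R ≤ t) : max 0 (min 1 ((r₀ + R - t) / R)) = 0 := by
  have h1 : (r₀ + R - t) / R ≤ 0 := div_nonpos_of_nonpos_of_nonneg (by linarith) hR.le
  rw [max_eq_left ((min_le_right _ _).trans h1)]

/-- the ramp is `1∕R`-Lipschitz (`max` and `min` are `1`-Lipschitz). [folklore] -/
private theorem abs_ramp_sub_ramp_le (hR : 0 < R) (t t' : ℝ) :
    |max 0 (min 1 ((r₀ + R - t) / R)) - max 0 (min 1 ((r₀ + R - t') / R))| ≤ |t - t'| / R := by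
  calc |max 0 (min 1 ((r₀ + R - t) / R)) - max 0 (min 1 ((r₀ + R - t') / R))|
      ≤ max |(0 : ℝ) - 0| |min 1 ((r₀ + R - t) / R) - min 1 ((r₀ + R - t') / R)| := abs_max_sub_max_le_max _ _ _ _
    _ = |min 1 ((r₀ + R - t) / R) - min 1 ((r₀ + R - t') / R)| := by
        rw [sub_self, abs_zero, max_eq_right (abs_nonneg _)]
    _ ≤ max |(1 : ℝ) - 1| |(r₀ + R - t) / R - (r₀ + R - t') / R| := abs_min_sub_min_le_max _ _ _ _
    _ = |(r₀ + R - t) / R - (r₀ + R - t') / R| := by rw [sub_self, abs_zero, max_eq_right (abs_nonneg _)]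
    _ = |t - t'| / R := by
        rw [← sub_div, abs_div, abs_of_pos hR, show r₀ + R - t - (r₀ + R - t') = -(t - t') by ring, abs_neg]

end Ramp

section Dist

variable {d : ℕ} {P : Fin d → ℕ}

/-- **the distance to a nonempty finite set is `1`-Lipschitz**: `|min_{y₀∈Y₀} d(y₀,y) − min_{y₀∈Y₀} d(y₀,y′)| ≤ d(y, y′)` (triangle inequality of the torus
sup-distance). [folklore] -/
private theorem abs_infDist_sub_infDist_le (hP : ∀ i, 1 ≤ P i) (Y₀ : Finset (TSite d P)) (hY₀ : Y₀.Nonempty) (y y' : TSite d P) :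
    |Y₀.inf' hY₀ (fun y₀ => tdist P y₀ y) - Y₀.inf' hY₀ (fun y₀ => tdist P y₀ y')| ≤ tdist P y y' := by
  -- one-sided: `D(y) ≤ D(y′) + d(y′, y)` and symmetrically
  have key : ∀ z z' : TSite d P, Y₀.inf' hY₀ (fun y₀ => tdist P y₀ z) ≤ Y₀.inf' hY₀ (fun y₀ => tdist P y₀ z') + tdist P z' z := by
    intro z z'
    obtain ⟨y₁, hy₁, e⟩ := Finset.exists_mem_eq_inf' hY₀ (fun y₀ => tdist P y₀ z')
    rw [e]
    exact (Finset.inf'_le (fun y₀ => tdist P y₀ z) hy₁).trans (tdist_triangle hP y₁ z' z)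
  rw [abs_sub_le_iff]
  constructor
  · have h := key y y'
    rw [tdist_symm hP y' y] at h
    linarith
  · have h := key y' y
    linarith

end Dist

/-! ## §2 The profile -/

section Profile

variable {d : ℕ} (L : ℕ) [NeZero L] (m : Fin d → ℕ)

/-- **A CUBE CUT-OFF PROFILE ON THE FINE TORUS** («h_□ = 1 on □, supported in □̃», |∇h| = O(M⁻¹)): for a coarse set `Y₀`, a radius `r₀`, `0 < R` there is a real profile `σ`
on the fine torus with `0 ≤ σ ≤ 1`, `σ(x) = 1` whenever `d_m(y₀, blk x) ≤ r₀` for some `y₀ ∈ Y₀`, `σ(x) = 0` whenever `d_m(y₀, blk x) ≥ r₀ + R` for all `y₀ ∈ Y₀`, bond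
slopes `|σ(b₋) − σ(b₊)| ≤ 1∕R` and second differences `|(σ(y) − σ(y−e_μ)) − (σ(y+e_μ) − σ(y))| ≤ 2∕R` (`σ = ramp ∘ dist(·, Y₀) ∘ blk`; the zero profile if `Y₀ = ∅`).
[folklore] [cite: Balaban1985BackgroundPropagators, p.408, (3.87)–(3.89) p.409, (3.100) p.413] -/
theorem exists_cube_cutoff_profile (hm : ∀ i, 1 ≤ m i) (Y₀ : Finset (TSite d m)) {r₀ R : ℝ} (hR : 0 < R) :
    ∃ σ : TSite d (fineP L m) → ℝ,
      (∀ x, 0 ≤ σ x ∧ σ x ≤ 1) ∧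
      (∀ x, (∃ y₀ ∈ Y₀, tdist m y₀ (blockCoord L m x) ≤ r₀) → σ x = 1) ∧
      (∀ x, (∀ y₀ ∈ Y₀, r₀ + R ≤ tdist m y₀ (blockCoord L m x)) → σ x = 0) ∧
      (∀ b : Bond d (fineP L m), |σ (bpos b) - σ (btgt b)| ≤ 1 / R) ∧
      (∀ (y : TSite d (fineP L m)) (μ : Fin d), |(σ y - σ (unshift μ y)) - (σ (shift μ y) - σ y)| ≤ 2 / R) := by
  rcases Y₀.eq_empty_or_nonempty with hY | hY₀
  · -- no support: the zero profile
    refine ⟨fun _ => 0, fun _ => ⟨le_rfl, zero_le_one⟩, fun x hx => ?_, fun _ _ => rfl, fun b => ?_, fun y μ => ?_⟩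
    · obtain ⟨y₀, hy₀, _⟩ := hx
      rw [hY] at hy₀
      exact absurd hy₀ (Finset.notMem_empty _)
    · rw [sub_self, abs_zero]; positivity
    · simp only [sub_self, abs_zero]; positivity
  -- the distance to `Y₀` on the coarse torus and the profile
  set D : TSite d m → ℝ := fun y => Y₀.inf' hY₀ (fun y₀ => tdist m y₀ y) with hD
  set σ : TSite d (fineP L m) → ℝ := fun x => max 0 (min 1 ((r₀ + R - D (blockCoord L m x)) / R)) with hσ
  have hLip : ∀ x x' : TSite d (fineP L m), |σ x - σ x'| ≤ tdist m (blockCoord L m x) (blockCoord L m x') / R := fun x x' =>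
    (abs_ramp_sub_ramp_le hR _ _).trans
      (div_le_div_of_nonneg_right (abs_infDist_sub_infDist_le hm Y₀ hY₀ _ _) hR.le)
  have hbond : ∀ (x : TSite d (fineP L m)) (μ : Fin d), |σ x - σ (shift μ x)| ≤ 1 / R := fun x μ =>
    (hLip x (shift μ x)).trans (div_le_div_of_nonneg_right (tdist_blockCoord_shift_le_one hm x μ) hR.le)
  refine ⟨σ, fun x => ramp_mem _, fun x hx => ?_, fun x hx => ?_, fun b => hbond (bpos b) b.2, fun y μ => ?_⟩
  · -- `σ = 1` within `r₀`
    obtain ⟨y₀, hy₀, hle⟩ := hx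
    have hDle : D (blockCoord L m x) ≤ r₀ := (Finset.inf'_le (fun y₀ => tdist m y₀ (blockCoord L m x)) hy₀).trans hle
    exact ramp_eq_one hR hDle
  · -- `σ = 0` beyond `r₀ + R`
    have hDge : r₀ + R ≤ D (blockCoord L m x) := by
      rw [hD]
      exact (Finset.le_inf'_iff hY₀ _).2 fun y₀ hy₀ => hx y₀ hy₀
    exact ramp_eq_zero hR hDge
  · -- second differences: two bond slopes
    have h1 : |σ y - σ (unshift μ y)| ≤ 1 / R := by
      have h := hbond (unshift μ y) μ
      rwa [B9SectCLatticeCarrier.shift_unshift, abs_sub_comm] at h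
    have h2 : |σ (shift μ y) - σ y| ≤ 1 / R := by rw [abs_sub_comm]; exact hbond y μ
    calc |(σ y - σ (unshift μ y)) - (σ (shift μ y) - σ y)| ≤ |σ y - σ (unshift μ y)| + |σ (shift μ y) - σ y| := abs_sub _ _
      _ ≤ 1 / R + 1 / R := add_le_add h1 h2
      _ = 2 / R := by ring

/-! ## §3 In the consumer's letters on the diagonal `Lη = 1` -/

/-- **THE PROFILE LETTERS OF S-P6′(β) INHABITED** (`B9Eq389CubeLocalisedProjectionProfile.norm_sub_projR_blockHull_le_of_profile`'s `hσ1, hnear, hσY, h1, h2`): on the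
diagonal `Lη = 1`, for a coarse set `Y₀`, a radius `r₀`, `0 < R`, with the cube `Y := {y : ∃ y₀ ∈ Y₀, d_m(y₀, y) < r₀ + R}`, there is a real profile `σ` with `|σ x − 1| ≤ 1`,
`σ x = 1` if `d_m(y₀, blk x) < r₀` for some `y₀ ∈ Y₀`, `σ x = 0` if `blk x ∉ Y`, `|σ(b₋) − σ(b₊)| ≤ (L∕R)·η`, `|(σ(y) − σ(y−e_μ)) − (σ(y+e_μ) − σ(y))| ≤ (2L²∕R)·η²` —
`ℓ₁ = L∕R`, `ℓ₂ = 2L²∕R` («O(M⁻¹)» with `M = R` coarse blocks, up to the fixed `L`). [folklore] [cite: Balaban1985BackgroundPropagators, p.408, (3.87)–(3.89) p.409, (3.100) p.413] -/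
theorem exists_cube_cutoff_profile_letters (hm : ∀ i, 1 ≤ m i) {η : ℝ} (hLη : (L : ℝ) * η = 1) (Y₀ : Finset (TSite d m)) {r₀ R : ℝ}
    (hR : 0 < R) :
    ∃ σ : TSite d (fineP L m) → ℝ,
      (∀ x, |σ x - 1| ≤ 1) ∧
      (∀ x, (∃ y₀ ∈ Y₀, tdist m y₀ (blockCoord L m x) < r₀) → σ x = 1) ∧
      (∀ x, blockCoord L m x ∉ {y : TSite d m | ∃ y₀ ∈ Y₀, tdist m y₀ y < r₀ + R} → σ x = 0) ∧
      (∀ b : Bond d (fineP L m), |σ (bpos b) - σ (btgt b)| ≤ ((L : ℝ) / R) * η) ∧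
      (∀ (y : TSite d (fineP L m)) (μ : Fin d), |(σ y - σ (unshift μ y)) - (σ (shift μ y) - σ y)| ≤ (2 * (L : ℝ) ^ 2 / R) * η ^ 2) := by
  obtain ⟨σ, h01, hone, hzero, hb, h2⟩ := exists_cube_cutoff_profile L m hm Y₀ hR
  have hL0 : (0 : ℝ) < (L : ℝ) := by exact_mod_cast NeZero.pos L
  have hη : η = 1 / (L : ℝ) := by rw [eq_div_iff hL0.ne', mul_comm]; exact hLη
  have e1 : ((L : ℝ) / R) * η = 1 / R := by rw [hη]; field_simp
  have e2 : (2 * (L : ℝ) ^ 2 / R) * η ^ 2 = 2 / R := by rw [hη]; field_simp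
  refine ⟨σ, fun x => ?_, fun x hx => ?_, fun x hx => hzero x fun y₀ hy₀ => ?_, fun b => by rw [e1]; exact hb b, fun y μ => by rw [e2]; exact h2 y μ⟩
  · obtain ⟨h0, h1⟩ := h01 x
    rw [abs_sub_le_iff]; constructor <;> linarith
  · obtain ⟨y₀, hy₀, hlt⟩ := hx
    exact hone x ⟨y₀, hy₀, hlt.le⟩
  · by_contra hlt
    exact hx ⟨y₀, hy₀, lt_of_not_ge hlt⟩

end Profile

end Literature.MathematicalPhysics.QuantumFieldTheory.Balaban1983to89.B9Eq387CubeCutoffProfile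

end
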